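import Summits.QuantumFields.YangMills.Theorems.WeakCouplingRatesBulkDominatesColdBoxWBallDatumLargeField
import HarnessLib

/-!
# The small-field variational problem of the box kernel, step V1: existence of a constrained minimiser and its energy
# bound (background brick for L1b `stub_goodBoundaryMeanSmooth` of crux `BulkDominatesColdBoxW`, stmt-QuantumFields-19609)

Helper file (`--supports stmt-QuantumFields-19609`; seat `ym-spine-20043-p1` g2, re-targeted by director-ym LINE №76/№78 to the
BACKGROUND piece of L1b).  Brick V1 of the card `BACKGROUND-BRICKS-19609-L1b.md` (evidence #13 on 19609).

The background `Ū_ω` of the one-scale expansion of the box kernel `γ_Λ(·|ω) = ymSpecification ρ β Λ ω` is the minimal-action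
configuration of the Wilson boundary action `S_Λ(ζ ∨ ω)` over the SMALL-FIELD REGION (every plaquette touching `Λ` within `κ`
of `1` in the representation `ρ`), for a datum `ω` whose links lie in the ball `‖ρ(ω_e) − 1‖ ≤ a` (the comb gauge of a
crude-good datum, bricks B1/B3 of ★ym-wcr-19609-p1).  This file proves, for every compact `G`, continuous unitary `ρ`, finite `Λ`:

* `smallFieldRegion ρ Λ η κ` — the region (a set of inner configurations `Λ → G`); `isClosed_smallFieldRegion`,
  `isCompact_smallFieldRegion` (closed in the compact `Λ → G`);
* `one_mem_smallFieldRegion` — the trivial extension `ζ ≡ 1` lies in it as soon as `4a ≤ κ` (`‖ρ(U_p) − 1‖ ≤ 4a` for links in the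
  `a`-ball, tree `norm_plaquetteHolonomyZd_sub_one_le`);
* **`exists_isMinOn_smallFieldRegion`** — there is a minimiser `ζ₀` of `ζ ↦ S_Λ(glueWith Λ ζ η)` on the region, and its action is
  at most `#(plaquettesTouching Λ) · 8m·a²` (comparison with `ζ ≡ 1`, tree `wilsonBoundaryAction_le_of_ball`).

Interior-ness of the minimiser (all plaquettes `≤ C·a ≪ κ`), uniqueness up to gauge, and the interior gradient estimate of its
curvature are bricks V2–V4 (the scalar/2-form interior estimate is landed: `HarmonicInterior.closed_coclosed_gradient_le`, p461897).
No sorry, standard axioms.  NOT a claim about the mass gap.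
-/

set_option autoImplicit false

noncomputable section

open Finset
open scoped Matrix.Norms.L2Operator
open Literature.Probability.LatticeModels (glueWith glueWith_apply_mem glueWith_apply_not_mem)
open Literature.MathematicalPhysics.QuantumLattice
open Literature.MathematicalPhysics.QuantumFieldTheory

namespace Summit.QuantumFields.YangMills.Theorems.WeakCouplingRates.Background

variable {d m : ℕ} {G : Type*} [Group G] [TopologicalSpace G] [IsTopologicalGroup G] [CompactSpace G]
  (ρ : G →* Matrix (Fin m) (Fin m) ℂ)

/-- The **small-field region** of inner configurations of `Λ` against the datum `η`: every plaquette touching `Λ` of the glued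
configuration is within `κ` of `1` in the representation `ρ`. -/
def smallFieldRegion (Λ : Finset (Literature.MathematicalPhysics.QuantumLattice.ZdEdge d)) (η : LGConfig d G) (κ : ℝ) : Set (↥Λ → G) :=
  {ζ | ∀ p ∈ plaquettesTouching Λ, ‖ρ (plaquetteHolonomyZd (glueWith Λ ζ η) p.1 p.2.1.1 p.2.1.2) - 1‖ ≤ κ}

omit [CompactSpace G] in
/-- The plaquette holonomy of the glued configuration depends continuously on the inner configuration. [folklore] -/
theorem continuous_plaquetteHolonomyZd_glueWith (hρc : Continuous ρ) (Λ : Finset (Literature.MathematicalPhysics.QuantumLattice.ZdEdge d)) (η : LGConfig d G)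
    (x : Literature.Probability.LatticeModels.Site d) (i j : Fin d) :
    Continuous fun ζ : ↥Λ → G => ρ (plaquetteHolonomyZd (glueWith Λ ζ η) x i j) := by
  have hg : Continuous fun ζ : ↥Λ → G => glueWith Λ ζ η :=
    (continuous_glueWith_prod Λ).comp (Continuous.prodMk_right η)
  refine hρc.comp ?_
  unfold plaquetteHolonomyZd
  have h1 : ∀ e : Literature.MathematicalPhysics.QuantumLattice.ZdEdge d, Continuous fun ζ : ↥Λ → G => glueWith Λ ζ η e := fun e => (continuous_apply e).comp hg
  exact (((h1 _).mul (h1 _)).mul (h1 _).inv).mul (h1 _).inv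

omit [CompactSpace G] in
/-- The small-field region is closed. [folklore] -/
theorem isClosed_smallFieldRegion (hρc : Continuous ρ) (Λ : Finset (Literature.MathematicalPhysics.QuantumLattice.ZdEdge d)) (η : LGConfig d G) (κ : ℝ) :
    IsClosed (smallFieldRegion ρ Λ η κ) := by
  have : smallFieldRegion ρ Λ η κ =
      ⋂ p ∈ plaquettesTouching Λ, {ζ : ↥Λ → G | ‖ρ (plaquetteHolonomyZd (glueWith Λ ζ η) p.1 p.2.1.1 p.2.1.2) - 1‖ ≤ κ} := by
    ext ζ; simp [smallFieldRegion]
  rw [this]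
  refine isClosed_biInter fun p _ => ?_
  exact isClosed_le (((continuous_plaquetteHolonomyZd_glueWith ρ hρc Λ η _ _ _).sub continuous_const).norm) continuous_const

/-- The small-field region is compact (closed in the compact space `Λ → G`). [folklore] -/
theorem isCompact_smallFieldRegion (hρc : Continuous ρ) (Λ : Finset (Literature.MathematicalPhysics.QuantumLattice.ZdEdge d)) (η : LGConfig d G) (κ : ℝ) :
    IsCompact (smallFieldRegion ρ Λ η κ) :=
  (isClosed_smallFieldRegion ρ hρc Λ η κ).isCompact

variable [NeZero m] (hρu : ∀ g, ρ g ∈ Matrix.unitaryGroup (Fin m) ℂ)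

include hρu in
omit [TopologicalSpace G] [IsTopologicalGroup G] [CompactSpace G] in
/-- For a datum in the `a`-ball, the trivial extension lies in the small-field region as soon as `4a ≤ κ`. [folklore] -/
theorem one_mem_smallFieldRegion {Λ : Finset (Literature.MathematicalPhysics.QuantumLattice.ZdEdge d)} {η : LGConfig d G} {a κ : ℝ} (ha : 0 ≤ a)
    (hη : ∀ e, ‖ρ (η e) - 1‖ ≤ a) (h4 : 4 * a ≤ κ) :
    (fun _ : ↥Λ => (1 : G)) ∈ smallFieldRegion ρ Λ η κ := by
  intro p _
  have hball : ∀ e, ‖ρ (glueWith Λ (fun _ : ↥Λ => (1 : G)) η e) - 1‖ ≤ a :=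
    norm_glueWith_sub_one_le ρ (fun _ => by rw [map_one, sub_self, norm_zero]; exact ha) hη
  exact (norm_plaquetteHolonomyZd_sub_one_le ρ hρu hball _ _ _).trans h4

include hρu in
/-- **Existence of the constrained minimiser and its energy bound.**  For continuous unitary `ρ`, a finite `Λ`, a datum `η` with
all links in the `a`-ball (`0 ≤ a`, `4a ≤ κ`): the boundary Wilson action `ζ ↦ S_Λ(glueWith Λ ζ η)` attains its minimum on the
small-field region at some `ζ₀`, and `S_Λ(glueWith Λ ζ₀ η) ≤ #(plaquettesTouching Λ) · 8m a²`. [folklore] -/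
theorem exists_isMinOn_smallFieldRegion (hρc : Continuous ρ) (Λ : Finset (Literature.MathematicalPhysics.QuantumLattice.ZdEdge d)) {η : LGConfig d G} {a κ : ℝ}
    (ha : 0 ≤ a) (hη : ∀ e, ‖ρ (η e) - 1‖ ≤ a) (h4 : 4 * a ≤ κ) :
    ∃ ζ₀ ∈ smallFieldRegion ρ Λ η κ,
      IsMinOn (fun ζ : ↥Λ → G => wilsonBoundaryAction ρ Λ (glueWith Λ ζ η)) (smallFieldRegion ρ Λ η κ) ζ₀ ∧
      wilsonBoundaryAction ρ Λ (glueWith Λ ζ₀ η) ≤ #(plaquettesTouching Λ) * (8 * m * a ^ 2) := by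
  have hne : (smallFieldRegion ρ Λ η κ).Nonempty := ⟨_, one_mem_smallFieldRegion ρ hρu ha hη h4⟩
  have hcont : Continuous fun ζ : ↥Λ → G => wilsonBoundaryAction ρ Λ (glueWith Λ ζ η) :=
    (continuous_wilsonBoundaryAction ρ hρc Λ).comp ((continuous_glueWith_prod Λ).comp (Continuous.prodMk_right η))
  obtain ⟨ζ₀, hζ₀, hmin⟩ := (isCompact_smallFieldRegion ρ hρc Λ η κ).exists_isMinOn hne hcont.continuousOn
  refine ⟨ζ₀, hζ₀, hmin, ?_⟩
  have h1 := hmin (one_mem_smallFieldRegion ρ hρu ha hη h4)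
  have hball : ∀ e, ‖ρ (glueWith Λ (fun _ : ↥Λ => (1 : G)) η e) - 1‖ ≤ a :=
    norm_glueWith_sub_one_le ρ (fun _ => by rw [map_one, sub_self, norm_zero]; exact ha) hη
  exact h1.trans (wilsonBoundaryAction_le_of_ball ρ hρu hball Λ)

end Summit.QuantumFields.YangMills.Theorems.WeakCouplingRates.Background

end
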